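import Mathlib
import HarnessLib

/-!
# Energy depth: a low-energy direction lives inside the bottom frame (Markov bound)
(pub-rhpf THEORY-4 §1 "energy depth", §3 Table A column `K99e`, §7.13 (b); mechanism search — no RH claims)

PROVED (kernel) form of the one-line estimate behind every "energy depth" number of THEORY-4.
Setting (the dictionary is THEOREM-informal, as for the other PfPersistence frame lemmas): `Q` is a
positive semidefinite real quadratic form on the even Galerkin block with eigenvalues listed in
ascending order `0 ≤ ε 0 ≤ ε 1 ≤ …` (a `Monotone` sequence `ε : ℕ → ℝ`; only the indices `< n` are
used) and orthonormal eigenvectors `u_k`; for a vector `u` put `c k := ⟨u, u_k⟩² ≥ 0` (total mass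
`M := Σ_{k<n} c k = ‖u‖²`) and `E := Q(u) = Σ_{k<n} ε k · c k`.  Then the mass of `u` outside the
bottom-`K` frame `span(u_0 … u_{K-1})` is at most `E / ε K`:

* `frameEnergy_split`            : `Σ_{k<K} c k + Σ_{K≤k<n} c k = Σ_{k<n} c k`;
* `energyDepth_outside_le`       : `ε K · Σ_{K≤k<n} c k ≤ Σ_{k<n} ε k · c k`            (Markov);
* `energyDepth_capture`          : `ε K · (M − Σ_{k<K} c k) ≤ E`;
* `energyDepth_capture_div`      : `M − E / ε K ≤ Σ_{k<K} c k`                  (`ε K > 0`);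
* `energyDepth_hiding_cost`      : if the capture `Σ_{k<K} c k ≤ M − θ` then `θ · ε K ≤ E` — a
  direction that keeps mass `θ` outside ζ's bottom-`K` frame pays ζ-energy at least `θ · ε_K`
  (the rule quoted to the fake seats, THEORY-4 §7.13 (b)(ii));
* `energyDepth_K99`              : if `100 · E ≤ ε K` then `Σ_{k<K} c k ≥ (99/100) · M`
  (the definition of the tabulated `K99e`).

Pure finite real algebra ([folklore]: Markov's inequality for the spectral measure of `u`); the
numbers `ε k`, `E` per window are DATA (two engines).  Decls live in `…PfPersistence.EnergyDepth`.
-/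

set_option linter.dupNamespace false  -- the mandated namespace repeats `RiemannHypothesis`

noncomputable section

open Real Finset

namespace Summit.RiemannHypothesis.RiemannHypothesis.Theorems.PfPersistence.EnergyDepth

/-- PROVED (bookkeeping): the frame split of the mass, `Σ_{k<K} c k + Σ_{K≤k<n} c k = Σ_{k<n} c k`
for `K ≤ n`. [folklore] -/
theorem frameEnergy_split {n K : ℕ} (hK : K ≤ n) (c : ℕ → ℝ) :
    ∑ k ∈ Finset.range K, c k + ∑ k ∈ Finset.Ico K n, c k = ∑ k ∈ Finset.range n, c k :=
  Finset.sum_range_add_sum_Ico c hK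

/-- PROVED (Markov bound): for an ascending nonnegative sequence `ε` and nonnegative weights `c`,
`ε K · Σ_{K≤k<n} c k ≤ Σ_{k<n} ε k · c k`. [folklore] -/
theorem energyDepth_outside_le {n K : ℕ} (hK : K ≤ n) (ε c : ℕ → ℝ) (hε : ∀ k, 0 ≤ ε k)
    (hmono : Monotone ε) (hc : ∀ k, 0 ≤ c k) :
    ε K * ∑ k ∈ Finset.Ico K n, c k ≤ ∑ k ∈ Finset.range n, ε k * c k := by
  calc ε K * ∑ k ∈ Finset.Ico K n, c k
      = ∑ k ∈ Finset.Ico K n, ε K * c k := by rw [Finset.mul_sum]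
    _ ≤ ∑ k ∈ Finset.Ico K n, ε k * c k := by
        apply Finset.sum_le_sum
        intro k hk
        exact mul_le_mul_of_nonneg_right (hmono (Finset.mem_Ico.mp hk).1) (hc k)
    _ ≤ ∑ k ∈ Finset.range K, ε k * c k + ∑ k ∈ Finset.Ico K n, ε k * c k := by
        have h0 : 0 ≤ ∑ k ∈ Finset.range K, ε k * c k :=
          Finset.sum_nonneg fun k _ => mul_nonneg (hε k) (hc k)
        linarith
    _ = ∑ k ∈ Finset.range n, ε k * c k := Finset.sum_range_add_sum_Ico _ hK

/-- PROVED (energy depth, product form): with total mass `M = Σ_{k<n} c k` and energy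
`E = Σ_{k<n} ε k · c k`, the bottom-`K` capture satisfies `ε K · (M − Σ_{k<K} c k) ≤ E`. [folklore] -/
theorem energyDepth_capture {n K : ℕ} (hK : K ≤ n) (ε c : ℕ → ℝ) (hε : ∀ k, 0 ≤ ε k)
    (hmono : Monotone ε) (hc : ∀ k, 0 ≤ c k) {M E : ℝ}
    (hM : ∑ k ∈ Finset.range n, c k = M) (hE : ∑ k ∈ Finset.range n, ε k * c k = E) :
    ε K * (M - ∑ k ∈ Finset.range K, c k) ≤ E := by
  have hsplit := frameEnergy_split hK c
  have h1 := energyDepth_outside_le hK ε c hε hmono hc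
  have hout : M - ∑ k ∈ Finset.range K, c k = ∑ k ∈ Finset.Ico K n, c k := by linarith
  rw [hout, ← hE]
  exact h1

/-- PROVED (energy depth, quotient form): if moreover `ε K > 0` then
`M − E / ε K ≤ Σ_{k<K} c k` — the mass outside the bottom-`K` frame is at most `E / ε K`. [folklore] -/
theorem energyDepth_capture_div {n K : ℕ} (hK : K ≤ n) (ε c : ℕ → ℝ) (hε : ∀ k, 0 ≤ ε k)
    (hmono : Monotone ε) (hc : ∀ k, 0 ≤ c k) (hK0 : 0 < ε K) {M E : ℝ}
    (hM : ∑ k ∈ Finset.range n, c k = M) (hE : ∑ k ∈ Finset.range n, ε k * c k = E) :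
    M - E / ε K ≤ ∑ k ∈ Finset.range K, c k := by
  have h1 := energyDepth_capture hK ε c hε hmono hc hM hE
  have h2 : M - ∑ k ∈ Finset.range K, c k ≤ E / ε K := by
    rw [le_div_iff₀ hK0, mul_comm]
    exact h1
  linarith

/-- PROVED (hiding cost, the fake-seat rule of THEORY-4 §7.13 (b)(ii)): if a direction keeps mass at
least `θ` outside the bottom-`K` frame, i.e. its capture is `≤ M − θ`, then its energy is at least
`θ · ε K`. [folklore] -/
theorem energyDepth_hiding_cost {n K : ℕ} (hK : K ≤ n) (ε c : ℕ → ℝ) (hε : ∀ k, 0 ≤ ε k)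
    (hmono : Monotone ε) (hc : ∀ k, 0 ≤ c k) {M E θ : ℝ}
    (hM : ∑ k ∈ Finset.range n, c k = M) (hE : ∑ k ∈ Finset.range n, ε k * c k = E)
    (hcap : ∑ k ∈ Finset.range K, c k ≤ M - θ) :
    θ * ε K ≤ E := by
  have h1 := energyDepth_capture hK ε c hε hmono hc hM hE
  have h2 : θ ≤ M - ∑ k ∈ Finset.range K, c k := by linarith
  calc θ * ε K ≤ (M - ∑ k ∈ Finset.range K, c k) * ε K :=
        mul_le_mul_of_nonneg_right h2 (hε K)
    _ = ε K * (M - ∑ k ∈ Finset.range K, c k) := by ring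
    _ ≤ E := h1

/-- PROVED (`K99e` of THEORY-4 §3 Table A): for a unit vector (`Σ_{k<n} c k = 1`), if `ε K > 0` and
`100 · E ≤ ε K` then the bottom-`K` frame captures at least `99/100` of the mass. [folklore] -/
theorem energyDepth_K99 {n K : ℕ} (hK : K ≤ n) (ε c : ℕ → ℝ) (hε : ∀ k, 0 ≤ ε k)
    (hmono : Monotone ε) (hc : ∀ k, 0 ≤ c k) (hK0 : 0 < ε K) {E : ℝ}
    (hM : ∑ k ∈ Finset.range n, c k = 1) (hE : ∑ k ∈ Finset.range n, ε k * c k = E)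
    (h100 : 100 * E ≤ ε K) :
    (99 : ℝ) / 100 ≤ ∑ k ∈ Finset.range K, c k := by
  have h1 := energyDepth_capture hK ε c hε hmono hc hM hE
  have h2 : 1 - ∑ k ∈ Finset.range K, c k ≤ E / ε K := by
    rw [le_div_iff₀ hK0, mul_comm]; exact h1
  have h3 : E / ε K ≤ 1 / 100 := by
    rw [div_le_div_iff₀ hK0 (by norm_num : (0:ℝ) < 100)]
    linarith
  linarith

end Summit.RiemannHypothesis.RiemannHypothesis.Theorems.PfPersistence.EnergyDepth

end
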